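import Mathlib
import Summits.Ventures.DiscreteObjects.Mahler.CensusSearchCuts

/-!
# The kernel census search with cuts: table validation, verdicts, chunking (venture `DiscreteObjects`, target L)

Cell `pub-namedobj`, seat `pub-namedobj-mahler-g13`. Framing: lottery ticket; floor = certified bounds/negative
ranges.

Companion of `CensusSearchCuts`: (1) a cut table `CT` is untrusted DATA, validated once against its generating integer
vectors by the Boolean `cutTableCheck` (exact rational arithmetic, `decide`) — `cutTableValid_of_check`; (2) the verdicts
`census_verdict_nonnegC` / `degreeCensus_of_certified_nonnegC` (certificates for the survivors with `c₁ ≥ 0` only, by the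
`x ↦ -x` symmetry of `CensusHalfSearch`) for the search with cuts; (3) `mem_censusSearchC_node_iff`, one level of the
search unfolded at a node carrying its power sums, used to split the kernel check into per-node theorems.
-/

namespace Summit.Ventures.DiscreteObjects.Mahler

open Polynomial

/-! ## Validating a cut table by computation (`B = Bn/Bd`) -/

/-- `[λ_k(v), …, λ_1(v)]`. -/
def lamRevList (v : List ℤ) (k : ℕ) : List ℤ := ((List.range k).map fun j => lamAt v (j + 1)).reverse

/-- The cut constant `2dλ₀ + Σ_{j≤k} |λ_j| (B^j + B^{-j} - 2)` over `ℚ`, `B = Bn/Bd`. -/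
def cutConstQ (d k Bn Bd : ℕ) (v : List ℤ) : ℚ :=
  2 * (d : ℚ) * (lamZero v : ℤ) +
    ∑ j ∈ Finset.range k, |((lamAt v (j + 1) : ℤ) : ℚ)| *
      (((Bn : ℚ) / Bd) ^ (j + 1) + (((Bn : ℚ) / Bd) ^ (j + 1))⁻¹ - 2)

/-- Boolean check of one cut against its generating vector. -/
def cutCheck (d k Bn Bd : ℕ) (v : List ℤ) (c : List ℤ × ℤ) : Bool :=
  (v.length == k + 1) && (c.1 == lamRevList v k) && decide (cutConstQ d k Bn Bd v < (c.2 : ℚ) + 1)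

/-- Boolean check of the cuts of one depth against their generating vectors (same order). -/
def cutsCheck (d k Bn Bd : ℕ) : List (List ℤ) → List (List ℤ × ℤ) → Bool
  | [], [] => true
  | v :: vs, c :: cs => cutCheck d k Bn Bd v c && cutsCheck d k Bn Bd vs cs
  | _, _ => false

/-- Boolean check of a whole table: `VT` lists the generating vectors depth by depth. -/
def cutTableCheck (d Bn Bd : ℕ) : ℕ → List (List (List ℤ)) → List (List (List ℤ × ℤ)) → Bool
  | _, [], [] => true
  | k, vs :: VT, cs :: CT => cutsCheck d k Bn Bd vs cs && cutTableCheck d Bn Bd (k + 1) VT CT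
  | _, _, _ => false

/-- `lamRevList` has length `k` and the stated entries. -/
theorem lamRevList_spec (v : List ℤ) (k : ℕ) :
    (lamRevList v k).length = k ∧ ∀ j < k, (lamRevList v k).getD (k - 1 - j) 0 = lamAt v (j + 1) := by
  unfold lamRevList
  refine ⟨by simp, ?_⟩
  intro j hj
  rw [List.getD_eq_getElem?_getD, List.getElem?_reverse (by simp; omega)]
  simp only [List.length_map, List.length_range, List.getElem?_map]
  rw [show k - 1 - (k - 1 - j) = j by omega, List.getElem?_range (by omega)]
  simp

/-- A checked cut is valid (for `B = Bn/Bd`, `Bd > 0`). -/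
theorem cutValid_of_check {d k Bn Bd : ℕ} {v : List ℤ} {c : List ℤ × ℤ}
    (h : cutCheck d k Bn Bd v c = true) : CutValid d k ((Bn : ℝ) / Bd) c := by
  simp only [cutCheck, Bool.and_eq_true, beq_iff_eq, decide_eq_true_eq] at h
  obtain ⟨⟨hv, hc1⟩, hlt⟩ := h
  obtain ⟨hlen, hget⟩ := lamRevList_spec v k
  refine ⟨by rw [hc1, hlen], v, hv, fun j hj => by rw [hc1, hget j hj], ?_⟩
  have hcast : (2 * (d : ℝ) * ((lamZero v : ℤ) : ℝ) +
      ∑ j ∈ Finset.range k, |((lamAt v (j + 1) : ℤ) : ℝ)| *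
        (((Bn : ℝ) / Bd) ^ (j + 1) + (((Bn : ℝ) / Bd) ^ (j + 1))⁻¹ - 2)) = ((cutConstQ d k Bn Bd v : ℚ) : ℝ) := by
    unfold cutConstQ; push_cast; rfl
  rw [hcast]
  exact_mod_cast hlt

/-- Checked cuts of one depth are valid. -/
theorem cutsValid_of_check {d k Bn Bd : ℕ} : ∀ (vs : List (List ℤ)) (cs : List (List ℤ × ℤ)),
    cutsCheck d k Bn Bd vs cs = true → ∀ c ∈ cs, CutValid d k ((Bn : ℝ) / Bd) c := by
  intro vs
  induction vs with
  | nil => intro cs h c hc; cases cs with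
    | nil => simp at hc
    | cons _ _ => simp [cutsCheck] at h
  | cons v vs ih =>
    intro cs h c hc
    cases cs with
    | nil => simp at hc
    | cons c' cs =>
      simp only [cutsCheck, Bool.and_eq_true] at h
      rcases List.mem_cons.mp hc with rfl | hc
      · exact cutValid_of_check h.1
      · exact ih cs h.2 c hc

/-- **A checked table is valid:** `cutTableCheck d Bn Bd 1 VT CT = true → CutTableValid d (Bn/Bd) CT`. -/
theorem cutTableValid_of_check {d Bn Bd : ℕ} {VT : List (List (List ℤ))}
    {CT : List (List (List ℤ × ℤ))} (h : cutTableCheck d Bn Bd 1 VT CT = true) :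
    CutTableValid d ((Bn : ℝ) / Bd) CT := by
  suffices H : ∀ (VT : List (List (List ℤ))) (CT : List (List (List ℤ × ℤ))) (k0 : ℕ),
      cutTableCheck d Bn Bd k0 VT CT = true → ∀ i < CT.length, ∀ c ∈ CT.getD i [], CutValid d (k0 + i) ((Bn : ℝ) / Bd) c by
    intro k hk1 _ c hc
    by_cases hi : k - 1 < CT.length
    · have := H VT CT 1 h (k - 1) hi c hc
      rwa [show 1 + (k - 1) = k by omega] at this
    · push Not at hi
      rw [List.getD_eq_default _ _ hi] at hc
      simp at hc
  intro VT
  induction VT with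
  | nil =>
    intro CT k0 h i hi c hc
    cases CT with
    | nil => simp at hi
    | cons _ _ => simp [cutTableCheck] at h
  | cons vs VT ih =>
    intro CT k0 h i hi c hc
    cases CT with
    | nil => simp at hi
    | cons cs CT =>
      simp only [cutTableCheck, Bool.and_eq_true] at h
      cases i with
      | zero =>
        rw [List.getD_cons_zero] at hc
        rw [Nat.add_zero]
        exact cutsValid_of_check vs cs h.1 c hc
      | succ i =>
        rw [List.getD_cons_succ] at hc
        have := ih CT (k0 + 1) h.2 i (by simpa using hi) c hc
        rwa [show k0 + 1 + i = k0 + (i + 1) by ring] at this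

/-! ## Verdicts (certificates for `c₁ ≥ 0` only) -/

/-- Every output of the search at node `a1 :: pre'` starts with `a1`. -/
theorem isPrefix_of_mem_censusSearchC (T : List ℕ) (CT : List (List (List ℤ × ℤ))) :
    ∀ (fuel : ℕ) (pre ps a : List ℤ), a ∈ censusSearchC T CT fuel pre ps → pre <+: a := by
  intro fuel
  induction fuel with
  | zero =>
    intro pre ps a h
    simp only [censusSearchC] at h
    split_ifs at h
    · rw [List.mem_singleton] at h; rw [h]
    · simp at h
  | succ fuel ih =>
    intro pre ps a h
    rw [censusSearchC, List.mem_flatMap] at h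
    obtain ⟨ak, -, h⟩ := h
    exact (List.prefix_append pre [ak]).trans (ih _ _ _ h)

/-- The head of an output below the node `[a1]`. -/
theorem getD_zero_of_mem_censusSearchC_cons {T : List ℕ} {CT : List (List (List ℤ × ℤ))} {fuel : ℕ} {a1 : ℤ}
    {pre' ps a : List ℤ} (h : a ∈ censusSearchC T CT fuel (a1 :: pre') ps) : a.getD 0 0 = a1 := by
  obtain ⟨t, ht⟩ := isPrefix_of_mem_censusSearchC T CT fuel (a1 :: pre') ps a h
  rw [← ht]; simp

/-- **Census verdict from certificates for `c₁ ≥ 0` only (search with cuts).** -/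
theorem census_verdict_nonnegC {Bn Bd d : ℕ} {T : List ℕ} {CT : List (List (List ℤ × ℤ))} {L : List (List ℤ)}
    (hBd : 0 < Bd) (hd : 1 ≤ d) (hdT : d ≤ T.length) (hT : ThresholdsValid d ((Bn : ℝ) / Bd) T)
    (hCT : CutTableValid d ((Bn : ℝ) / Bd) CT)
    (hcert : ∀ a ∈ censusSearchC T CT d [] [], 0 ≤ a.getD 0 0 →
      ∃ c, checkCert Bn Bd (2 * d) L (1 :: palC a) c = true)
    {p : ℤ[X]} (hmonic : p.Monic) (hdeg : p.natDegree = 2 * d)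
    (hpal : ∀ j ≤ 2 * d, p.coeff j = p.coeff (2 * d - j)) (hirr : Irreducible p)
    (h1 : 1 < intMahlerMeasure p) (hB : intMahlerMeasure p < (Bn : ℝ) / Bd) :
    ∃ l ∈ L, p = ofCoeffs l ∨ p = (ofCoeffs l).comp (-X) := by
  have key : ∀ q : ℤ[X], q.Monic → q.natDegree = 2 * d → (∀ j ≤ 2 * d, q.coeff j = q.coeff (2 * d - j)) →
      Irreducible q → 1 < intMahlerMeasure q → intMahlerMeasure q < (Bn : ℝ) / Bd → 0 ≤ q.coeff (2 * d - 1) →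
      ∃ l ∈ L, q = ofCoeffs l ∨ q = (ofCoeffs l).comp (-X) := by
    intro q hqm hqd hqp hqi hq1 hqB hq0
    have hmem := take_descCoeffList_mem_censusSearchC hd hqm hqd hqp hqB hdT hT hCT
    obtain ⟨c, hc⟩ := hcert _ hmem (by rw [getD_zero_take_descCoeffList hd hqd]; exact hq0)
    rw [palC_take_descCoeffList hd hqm hqd hqp] at hc
    have hp := eq_ofCoeffs_descCoeffList hqm hqd hqp
    have hmon' : (ofCoeffs (1 :: descCoeffList q)).Monic := by rw [← hp]; exact hqm
    have hdeg' : (ofCoeffs (1 :: descCoeffList q)).natDegree = 2 * d := by rw [← hp]; exact hqd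
    have hs := checkCert_sound hBd hc hmon' hdeg'
    rw [← hp] at hs
    rcases hs with h | h | h | h
    · rw [h] at hq1; exact absurd hq1 (lt_irrefl _)
    · exact absurd hqi h
    · exact absurd hqB (not_lt.mpr h.le)
    · exact h
  by_cases h0 : 0 ≤ p.coeff (2 * d - 1)
  · exact key p hmonic hdeg hpal hirr h1 hB h0
  · push Not at h0
    obtain ⟨hqm, hqd, hqp, hqc⟩ := comp_neg_X_palindromic hd hmonic hdeg hpal
    have hq := key (p.comp (-X)) hqm hqd hqp (irreducible_comp_neg_X hirr)
      (by rw [intMahlerMeasure_comp_neg_X]; exact h1) (by rw [intMahlerMeasure_comp_neg_X]; exact hB)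
      (by rw [hqc]; omega)
    obtain ⟨l, hl, h⟩ := hq
    refine ⟨l, hl, ?_⟩
    rcases h with h | h
    · right; rw [← h, comp_neg_X_comp_neg_X]
    · left
      have := congrArg (fun r : ℤ[X] => r.comp (-X)) h
      simpa only [comp_neg_X_comp_neg_X] using this

/-- **From the halved kernel check (search with cuts) to a census row** (`B = Bn/Bd ≤ θ₀`). -/
theorem degreeCensus_of_certified_nonnegC {Bn Bd d : ℕ} {T : List ℕ} {CT : List (List (List ℤ × ℤ))}
    {L : List (List ℤ)} (hBd : 0 < Bd) (hd : 1 ≤ d) (hdT : d ≤ T.length) (hT : ThresholdsValid d ((Bn : ℝ) / Bd) T)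
    (hCT : CutTableValid d ((Bn : ℝ) / Bd) CT) (hθ : (Bn : ℝ) / Bd ≤ smythTheta)
    (hcert : ∀ a ∈ censusSearchC T CT d [] [], 0 ≤ a.getD 0 0 →
      ∃ c, checkCert Bn Bd (2 * d) L (1 :: palC a) c = true) :
    DegreeCensus (2 * d) ((Bn : ℝ) / Bd) L := by
  intro p hdeg hirr h1 h2
  have hrev := (reciprocal_of_measure_lt_smythTheta hirr h1 (lt_of_lt_of_le h2 hθ)).1
  have hlc : (|p.leadingCoeff| : ℝ) ≤ intMahlerMeasure p := abs_leadingCoeff_le_intMahlerMeasure p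
  have hθ2 : smythTheta < 2 := by have := smythTheta_lt; linarith
  have hlc1 : p.leadingCoeff = 1 ∨ p.leadingCoeff = -1 := by
    have hne : p.leadingCoeff ≠ 0 := leadingCoeff_ne_zero.mpr hirr.ne_zero
    have hle : |p.leadingCoeff| ≤ 1 := by
      by_contra h
      push Not at h
      have : (2 : ℝ) ≤ (|p.leadingCoeff| : ℝ) := by
        have : (2 : ℤ) ≤ |p.leadingCoeff| := h
        exact_mod_cast this
      linarith
    rcases abs_le.mp hle with ⟨h1', h2'⟩
    omega
  obtain ⟨hmonic, hpm, hMm, hdegm, hirrm⟩ := monic_normalisation hlc1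
  set q := C p.leadingCoeff * p with hq
  have hrevq : q.reverse = q := by rw [hq, reverse_mul_of_domain, reverse_C, hrev]
  rw [hdeg] at hdegm
  have hpal := palindromic_of_reverse_eq_self q (2 * d) hdegm hrevq
  rw [← hMm] at h1 h2
  obtain ⟨l, hl, hql⟩ := census_verdict_nonnegC hBd hd hdT hT hCT hcert hmonic hdegm hpal (hirrm hirr) h1 h2
  refine ⟨l, hl, ?_⟩
  rcases hlc1 with hc | hc
  · have hpq : p = q := by rw [hpm, hc, C_1, one_mul]
    rcases hql with h | h
    · exact Or.inl (hpq.trans h)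
    · exact Or.inr (Or.inr (Or.inl (hpq.trans h)))
  · have hpq : p = -q := by
      conv_lhs => rw [hpm, hc]
      simp
    rcases hql with h | h
    · exact Or.inr (Or.inl (by rw [hpq, h]))
    · exact Or.inr (Or.inr (Or.inr (by rw [hpq, h])))

/-! ## One level of the search, unfolded (for chunking the kernel check) -/

/-- Range ends of the next coefficient at the node `(pre, ps)`. -/
def nodeLoC (T : List ℕ) (CT : List (List (List ℤ × ℤ))) (pre ps : List ℤ) : ℤ :=
  -(((cutBounds (CT.getD pre.length []) ps (-((T.getD pre.length 0 : ℕ) : ℤ)) ((T.getD pre.length 0 : ℕ) : ℤ)).2 -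
      -(List.zipWith (· * ·) pre ps).sum) / ((pre.length + 1 : ℕ) : ℤ))

/-- Range ends of the next coefficient at the node `(pre, ps)`. -/
def nodeHiC (T : List ℕ) (CT : List (List (List ℤ × ℤ))) (pre ps : List ℤ) : ℤ :=
  (-(List.zipWith (· * ·) pre ps).sum -
      (cutBounds (CT.getD pre.length []) ps (-((T.getD pre.length 0 : ℕ) : ℤ)) ((T.getD pre.length 0 : ℕ) : ℤ)).1) /
    ((pre.length + 1 : ℕ) : ℤ)

/-- The next power sum at the node `(pre, ps)` for the coefficient `ak`. -/
def nodeP (pre ps : List ℤ) (ak : ℤ) : ℤ := -(((pre.length + 1 : ℕ) : ℤ) * ak) + -(List.zipWith (· * ·) pre ps).sum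

/-- The power sums carried by the search after one more coefficient. -/
theorem psumsRev_append_single (pre : List ℤ) (ak : ℤ) :
    psumsRev (pre ++ [ak]) (pre.length + 1) = nodeP pre (psumsRev pre pre.length) ak :: psumsRev pre pre.length := by
  have htake : (pre ++ [ak]).take pre.length = pre := by simp
  have hn : psumsRev (pre ++ [ak]) pre.length = psumsRev pre pre.length := by
    rw [← psumsRev_take (pre ++ [ak]) pre.length pre.length le_rfl, htake]
  rw [psumsRev_succ, hn, nodeP, newtonNext, length_psumsRev,
    List.getD_eq_getElem?_getD, List.getElem?_append_right le_rfl, Nat.sub_self, List.getElem?_cons_zero,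
    Option.getD_some, ← zipWith_take_left _ (pre ++ [ak]) _ pre.length (by simp), htake, sub_eq_add_neg]

/-- One level of `censusSearchC`, unfolded at an arbitrary node. -/
theorem mem_censusSearchC_succ_iff {T : List ℕ} {CT : List (List (List ℤ × ℤ))} {f : ℕ} {pre ps a : List ℤ} :
    a ∈ censusSearchC T CT (f + 1) pre ps ↔
      ∃ ak ∈ icc (nodeLoC T CT pre ps) (nodeHiC T CT pre ps),
        a ∈ censusSearchC T CT f (pre ++ [ak]) (nodeP pre ps ak :: ps) := by
  rw [censusSearchC, List.mem_flatMap]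
  rfl

/-- One level of `censusSearchC` at a node carrying its own power sums (`n = |pre|`): the form used to split the
kernel check into per-node theorems. -/
theorem mem_censusSearchC_node_iff {T : List ℕ} {CT : List (List (List ℤ × ℤ))} {f n : ℕ} {pre a : List ℤ}
    (hn : pre.length = n) :
    a ∈ censusSearchC T CT (f + 1) pre (psumsRev pre n) ↔
      ∃ ak ∈ icc (nodeLoC T CT pre (psumsRev pre n)) (nodeHiC T CT pre (psumsRev pre n)),
        a ∈ censusSearchC T CT f (pre ++ [ak]) (psumsRev (pre ++ [ak]) (n + 1)) := by
  subst hn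
  rw [mem_censusSearchC_succ_iff]
  simp only [psumsRev_append_single]

end Summit.Ventures.DiscreteObjects.Mahler
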